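import Summits.BirchSwinnertonDyer.BirchSwinnertonDyer.Theses.RamifiedHeegnerPair
import Summits.BirchSwinnertonDyer.Rank1Residual.Additive.X4RankZeroKatoBoundTamagawaExact
import Literature.NumberTheory.EllipticCurves.Kato2004.Condition1252
import HarnessLib

/-!
# Route `RamifiedHeegnerPair`, residual member U₀ `LeafRankZeroUpperAtThree` (stmt-BirchSwinnertonDyer-26024): the UPPER half
# on every 3-adic-TOWER row is PRINT — Kato 2004 Thm. 14.5 (3) + Prop. 14.16 (2) in the TAMAGAWA-EXACT reading — so U₀'s
# residual content is only the NON-tower rows (no `surj(9)`)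

HONEST FRAMING. Theorems only; helper file (`--supports stmt-BirchSwinnertonDyer-26024`); no definition, no named fact, no `sorry`;
nothing is booked, no item is closed, BSD is not proved for any curve; CONDITIONAL on the displayed named facts. Lead prover
bsd-line-rhp-p1 g3 (L₁ lead; U₀ is a declared residual of the route with no seat), 2026-08-28.

WHY. The route text of 26024 (pen pss3 g16, rev 7) prices U₀ as «PRINT on the Kato-sharp rows (3-adic tower image onto ∧
`3 ∤ ∏ c_ℓ` ∧ `3 ∤ c_D`: `leafRankZeroUpper_three_of_kato_on_sharp_rows`, p606731); open off rows (284 onto-but-Tamagawa classes +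
53 normaliser-image classes of the 705 r0 Gss2 classes)». That pricing uses Kato's reading A161
(`Kato2004.rankZero_padicValNat_sha_le_of_additive_potGood_of_imageContainsSL2`, with the Tamagawa and Manin binders). The tree
ALSO holds the Tamagawa-EXACT, Manin-FREE reading A161″ of the same pages
(`Kato2004.rankZero_padicValNat_sha_add_padicValNat_tamagawa_le_of_additive_potGood_of_imageContainsSL2`:
`ord_p #Ш(E)[p^∞] + v_p(∏_ℓ c_ℓ) ≤ ord_p(L(E,1)/Ω)`; Kato 14.5 (3) into Prop. 14.16 (2) with Greenberg's Cassels-type exactness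
LNM 1716 Prop. 4.13 for `[S(T):Sel(T)] = ∏ c_ℓ^{(p)}`; typed by cell b2b, audit `KATO2004-TYPING.md` §29) and its consumer
`X4RankZero.missingUpperBoundAt_of_katoTam` at EVERY odd additive potentially good `p` with tower surjectivity — NO Tamagawa and
NO Manin binder. On the Gss2 leaf (`Addv ∧ SubGss`: class X4 with `0 ≤ ord₃ j` once `ρ̄₃` is onto,
`RamifiedPairUpperBound.classX4_three_and_potGood_of_subGss_of_surj`) this reads:

* `leafRankZeroUpper_three_towerRows_of_katoTam` — for every globally minimal `E` additive (G) ∧ ss at `3` with `r_an(E) = 0` and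
  `ρ_{E,3^n}` onto for all `n` (⟸ `surj(9)`): `Typed.MissingUpperBoundAt E 3`, from A161″ + GZK + modularity. The «284
  onto-but-Tamagawa» classes of the census LEAVE U₀'s residual as soon as they carry a mod-9 certificate;
* `leafRankZeroUpperAtThree_of_katoTam_of_nonTower` / `…_of_nonSurjNine` — 26024 BY NAME with the non-tower (resp. no-`surj(9)`)
  rows displayed as the residual hypothesis.

This is also the input the L₁ road (`…Gss2LowerAtThreeRankOneKolyvaginRoad.lean`, p610432) spends on the rank-0 TWIST inside its
pointwise door. References: [cite: Kato2004Asterisque, Thm. 14.5 (3) (p. 236), Prop. 14.16 (2) (p. 244), §14.8 (p. 238), (12.5.2)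
(p. 222)] [cite: GreenbergLNM1716, Prop. 4.13] [cite: SerreAbelianLadic1968, IV §3.4 Lemma 3] [cite: Miller2011LMS, Def. 1.1].
-/

-- D-0017: single-problem summit, so `Summit.BirchSwinnertonDyer.BirchSwinnertonDyer.…` repeats a namespace BY DESIGN.
set_option linter.dupNamespace false
set_option autoImplicit false

noncomputable section

open scoped Classical

open WeierstrassCurve Literature.NumberTheory.EllipticCurves Literature.NumberTheory.EllipticCurves.Rank1Residual
  Literature.NumberTheory.EllipticCurves.Rank1Residual.Typed
  Summit.BirchSwinnertonDyer.Rank1Residual Summit.BirchSwinnertonDyer.Rank1Residual.Additive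

namespace Summit.BirchSwinnertonDyer.BirchSwinnertonDyer.Theorems.RamifiedPairUpperBound

/-- **U₀ on the 3-adic-tower rows of the Gss2 leaf is PRINT (Kato 14.5 (3) + 14.16 (2), Tamagawa-exact).** GIVEN the named facts
A161″ (`hKatoT`), Gross–Zagier–Kolyvagin (`hGZK`) and modularity (`hmod`): for every globally minimal `E/ℚ` additive (G) ∧ ss at `3`
with `ord_{s=1} L(E,s) = 0` and `ρ_{E,3^n}` onto for every `n`, `Typed.MissingUpperBoundAt E 3` (`ord₃ #Ш(E) ≤ ord₃ #Ш_an(E)`).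
One line over `X4RankZero.missingUpperBoundAt_of_katoTam` (class X4 from `surj(3)`, `0 ≤ ord₃ j` from (G)).
No Tamagawa, no Manin, no CM hypothesis. [cite: Kato2004Asterisque, Thm. 14.5 (3) (p. 236), Prop. 14.16 (2) (p. 244)]
[cite: GreenbergLNM1716, Prop. 4.13] [cite: Miller2011LMS, Def. 1.1] -/
theorem leafRankZeroUpper_three_towerRows_of_katoTam
    (hKatoT : Kato2004.rankZero_padicValNat_sha_add_padicValNat_tamagawa_le_of_additive_potGood_of_imageContainsSL2)
    (hGZK : rank_eq_analyticRank_of_analyticRank_le_one) (hmod : hasEntireLFunction_rat) :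
    ∀ (W : WeierstrassCurve ℚ) [W.IsElliptic] [W.IsGloballyMinimal],
      Addv W 3 → SubGss W 3 → W.analyticRank = 0 →
      (∀ n : ℕ, W.HasSurjectiveModNGaloisRep (3 ^ n : ℕ)) → MissingUpperBoundAt W 3 := by
  intro W _ _ hadd hsub hr hsurj
  haveI : Fact (Nat.Prime 3) := ⟨Nat.prime_three⟩
  -- class X4 at `3` with `0 ≤ ord₃ j` (as rhp-p2's `classX4_three_and_potGood_of_subGss_of_surj`, inlined)
  have hirr : W.HasIrreducibleModPGaloisRep 3 := by
    haveI : NeZero ((3 : ℕ) : ℚ) := ⟨by norm_num⟩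
    exact hasIrreducibleModPGaloisRep_of_hasSurjectiveModNGaloisRep W 3 (by simpa using hsurj 1)
  have hX : ClassX4 W 3 := ⟨by norm_num, hadd, hirr⟩
  exact X4RankZero.missingUpperBoundAt_of_katoTam W 3 hKatoT hGZK hmod hr hX (not_lt.mp hsub.1.1) hsurj

/-- **26024 `LeafRankZeroUpperAtThree` BY NAME ⟸ A161″ ∧ GZK ∧ modularity ∧ [U₀ on the NON-tower rows].** The honest split by
the 3-adic image: the tower rows are print, the rest (`ρ̄₃` not onto — 53 normaliser-image r0 classes in the census — or onto
without a mod-`9` certificate) is displayed as `hNT`. Closes nothing. [cite: Kato2004Asterisque, Thm. 14.5 (3) (p. 236)]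
[cite: Miller2011LMS, Def. 1.1] -/
theorem leafRankZeroUpperAtThree_of_katoTam_of_nonTower
    (hKatoT : Kato2004.rankZero_padicValNat_sha_add_padicValNat_tamagawa_le_of_additive_potGood_of_imageContainsSL2)
    (hGZK : rank_eq_analyticRank_of_analyticRank_le_one) (hmod : hasEntireLFunction_rat)
    (hNT : ∀ (W : WeierstrassCurve ℚ) [W.IsElliptic] [W.IsGloballyMinimal],
      ¬ W.HasCM → Addv W 3 → SubGss W 3 → W.analyticRank = 0 →
      ¬ (∀ n : ℕ, W.HasSurjectiveModNGaloisRep (3 ^ n : ℕ)) → MissingUpperBoundAt W 3) :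
    Summit.BirchSwinnertonDyer.BirchSwinnertonDyer.Theses.RamifiedHeegnerPair.LeafRankZeroUpperAtThree := by
  intro W _ _ hCM hadd hsub hr
  by_cases hρ : ∀ n : ℕ, W.HasSurjectiveModNGaloisRep (3 ^ n : ℕ)
  · exact leafRankZeroUpper_three_towerRows_of_katoTam hKatoT hGZK hmod W hadd hsub hr hρ
  · exact hNT W hCM hadd hsub hr hρ

/-- **26024 BY NAME, residual rows = «no `surj(9)`»**: as above with the tower discharged from the finite certificate `surj(9)`
(`forall_hasSurjectiveModNGaloisRep_three_pow_of_nine`, Serre IV §3.4 Lemma 3). Closes nothing.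
[cite: SerreAbelianLadic1968, IV §3.4 Lemma 3 (IV-23)] [cite: Kato2004Asterisque, Thm. 14.5 (3) (p. 236)] [cite: Miller2011LMS, Def. 1.1] -/
theorem leafRankZeroUpperAtThree_of_katoTam_of_nonSurjNine
    (hKatoT : Kato2004.rankZero_padicValNat_sha_add_padicValNat_tamagawa_le_of_additive_potGood_of_imageContainsSL2)
    (hGZK : rank_eq_analyticRank_of_analyticRank_le_one) (hmod : hasEntireLFunction_rat)
    (hN9 : ∀ (W : WeierstrassCurve ℚ) [W.IsElliptic] [W.IsGloballyMinimal],
      ¬ W.HasCM → Addv W 3 → SubGss W 3 → W.analyticRank = 0 →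
      ¬ W.HasSurjectiveModNGaloisRep 9 → MissingUpperBoundAt W 3) :
    Summit.BirchSwinnertonDyer.BirchSwinnertonDyer.Theses.RamifiedHeegnerPair.LeafRankZeroUpperAtThree := by
  refine leafRankZeroUpperAtThree_of_katoTam_of_nonTower hKatoT hGZK hmod ?_
  intro W _ _ hCM hadd hsub hr hρ
  refine hN9 W hCM hadd hsub hr fun h9 ↦ hρ ?_
  exact WeierstrassCurve.forall_hasSurjectiveModNGaloisRep_three_pow_of_nine W h9

end Summit.BirchSwinnertonDyer.BirchSwinnertonDyer.Theorems.RamifiedPairUpperBound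

end
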